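import Mathlib
import Literature.Analysis.Fourier.RadialSchwartzInterpolationFlatSqrt
import Summits.AtomisticToContinuum.HydrodynamicLimit.Theorems.ImplosionDichotomyDenseExcursionSonicSmoothBranchCkEuler
import Summits.AtomisticToContinuum.HydrodynamicLimit.Theorems.ImplosionDichotomyDenseExcursionR2Modes

/-!
# Even smooth functions of the radius are smooth on `ℝ³` (for theorem T3, existence half)
# (crux `DenseExcursion`, line `sonic-cavity-renewal`, stub `stub_cavityResolventCk`)

Helper file (`--supports stmt-AtomisticToContinuum-12586`, line lead a2, stub-worker E for `stub_cavityResolventCk`,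
theorem T3 `centre_regular_branch`, EXISTENCE half). Registered helper `contDiff_norm_comp_of_even`: if `u : ℝ → ℂ` is
`C^∞` and EVEN then `y ↦ u ‖y‖` is `C^∞` on `ℝ³` (`V3`). This is the (easy) direction of Whitney's even-function theorem
that turns the regular branch of the resolvent equation in the signed radius `R` (an even smooth pair `(u, c)`,
`u = ŵ(log|R|)`, `c = |R|ŝ(log|R|)`) into the smooth fields on `ℝ³` demanded by `IsRegularPair`
(`Re/Im ŵ(log‖y‖)·y = Re/Im u(‖y‖)·y`, `‖y‖·Re/Im ŝ(log‖y‖) = Re/Im c(‖y‖)`), WITHOUT the hard direction (which is not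
in Mathlib). Proof, for each finite order `m`: the odd derivatives of `u` at `0` vanish, so `u` minus its Taylor polynomial
of order `4m + 3` is flat of order `4m + 4` and `s ↦ (u − T)(√s)` is `C^m`
(`Literature.Analysis.Fourier.contDiff_comp_sqrt_of_flat`); composing with the smooth `‖y‖²` and adding the Taylor part,
a polynomial in `‖y‖²`, gives `y ↦ u ‖y‖ ∈ C^m`. Sources: folklore (Whitney 1943, easy half).
-/

noncomputable section

open Set Filter Nat
open scoped Topology ContDiff

namespace Summit.AtomisticToContinuum.HydrodynamicLimit.Theorems.SonicCavityRenewal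

open Literature.MathematicalPhysics.KineticTheory (V3)

/-- The odd derivatives of an even smooth function vanish at the origin. [folklore] -/
theorem iteratedDeriv_eq_zero_of_even {u : ℝ → ℂ} (heven : ∀ t, u (-t) = u t) {n : ℕ} (hn : Odd n) :
    iteratedDeriv n u 0 = 0 := by
  have h : (fun x => u (-x)) = u := funext heven
  have h2 := iteratedDeriv_comp_neg n u 0
  rw [h, neg_zero, hn.neg_one_pow, neg_one_smul] at h2
  linear_combination (1 / 2 : ℂ) * h2

/-- The chain of iterated derivatives of a smooth function (global form). [folklore] -/
theorem hasDerivAt_iteratedDeriv_of_contDiff {u : ℝ → ℂ} (hu : ContDiff ℝ ∞ u) (j : ℕ) (t : ℝ) :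
    HasDerivAt (iteratedDeriv j u) (iteratedDeriv (j + 1) u t) t := by
  rw [iteratedDeriv_succ]
  exact (hu.differentiable_iteratedDeriv j (WithTop.coe_lt_coe.2 (ENat.coe_lt_top j))).differentiableAt.hasDerivAt

/-- **Registered helper `contDiff_norm_comp_of_even`: AN EVEN SMOOTH FUNCTION OF THE RADIUS IS SMOOTH ON `ℝ³`.** If
`u : ℝ → ℂ` is `C^∞` with `u(−t) = u(t)` then `y ↦ u ‖y‖` is `C^∞` on `V3 = ℝ³` (see the module docstring). [folklore] -/
theorem contDiff_norm_comp_of_even : ∀ (u : ℝ → ℂ), ContDiff ℝ ∞ u → (∀ t, u (-t) = u t) → ContDiff ℝ ∞ (fun y : V3 => u ‖y‖) := by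
  intro u hu heven
  refine contDiff_infty.2 fun m => ?_
  set N : ℕ := 2 * m + 2 with hN
  set c : ℕ → ℂ := fun n => iteratedDeriv n u 0 with hc
  -- the Taylor family `D j = u⁽ʲ⁾ − (Taylor sum of order 2N − 1 − j)`
  set D : ℕ → ℝ → ℂ := fun j t =>
    iteratedDeriv j u t - ∑ n ∈ Finset.range (2 * N - j), c (n + j) / (n ! : ℂ) * (t : ℂ) ^ n with hD_def
  have hD : ∀ j t, HasDerivAt (D j) (D (j + 1) t) t := fun j t =>
    (hasDerivAt_iteratedDeriv_of_contDiff hu j t).sub (hasDerivAt_taylorSum_family c (2 * N) j t)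
  have hD0 : ∀ j < 2 * N, D j 0 = 0 := by
    intro j hj
    show iteratedDeriv j u 0 - ∑ n ∈ Finset.range (2 * N - j), c (n + j) / (n ! : ℂ) * ((0 : ℝ) : ℂ) ^ n = 0
    rw [taylorSum_family_zero c (2 * N) j, if_pos hj]
    simp [hc]
  have hiter : ∀ j, iteratedDeriv j (D 0) = D j := by
    intro j
    induction j with
    | zero => simp
    | succ j ih =>
      rw [iteratedDeriv_succ, ih]
      exact funext fun t => (hD j t).deriv
  -- `ρ = D 0` is smooth and flat of order `2N = 4m + 4`
  have hpoly : ContDiff ℝ ∞ fun t : ℝ => ∑ n ∈ Finset.range (2 * N), c n / (n ! : ℂ) * (t : ℂ) ^ n :=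
    ContDiff.sum fun n _ => contDiff_const.mul (Complex.ofRealCLM.contDiff.pow n)
  have hρ : ContDiff ℝ ∞ (D 0) := by
    have : D 0 = fun t => u t - ∑ n ∈ Finset.range (2 * N), c n / (n ! : ℂ) * (t : ℂ) ^ n := by
      funext t; simp [hD_def]
    rw [this]
    exact hu.sub hpoly
  have hflat : ∀ j < 4 * m + 4, iteratedDeriv j (D 0) 0 = 0 := by
    intro j hj
    rw [hiter]
    exact hD0 j (by omega)
  have hsq := Literature.Analysis.Fourier.contDiff_comp_sqrt_of_flat hρ m hflat
  -- the flat part on `ℝ³`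
  have hflat3 : ContDiff ℝ m fun y : V3 => D 0 ‖y‖ := by
    have h1 : ContDiff ℝ m fun y : V3 => D 0 (Real.sqrt (‖y‖ ^ 2)) := hsq.comp (contDiff_norm_sq ℝ)
    have h2 : (fun y : V3 => D 0 ‖y‖) = fun y : V3 => D 0 (Real.sqrt (‖y‖ ^ 2)) := by
      funext y; rw [Real.sqrt_sq (norm_nonneg y)]
    rw [h2]; exact h1
  -- the Taylor part on `ℝ³`: odd coefficients vanish, even powers of `‖y‖` are powers of `‖y‖²`
  have hpoly3 : ContDiff ℝ m fun y : V3 => ∑ n ∈ Finset.range (2 * N), c n / (n ! : ℂ) * ((‖y‖ : ℝ) : ℂ) ^ n := by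
    refine ContDiff.sum fun n _ => ?_
    rcases Nat.even_or_odd n with ⟨i, rfl⟩ | hodd
    · have : (fun y : V3 => c (i + i) / ((i + i) ! : ℂ) * ((‖y‖ : ℝ) : ℂ) ^ (i + i)) =
          fun y : V3 => c (i + i) / ((i + i) ! : ℂ) * (((‖y‖ ^ 2 : ℝ)) : ℂ) ^ i := by
        funext y; push_cast; ring
      rw [this]
      exact contDiff_const.mul ((Complex.ofRealCLM.contDiff.comp (contDiff_norm_sq ℝ)).pow i)
    · have h0 : c n = 0 := iteratedDeriv_eq_zero_of_even heven hodd
      simp only [h0, zero_div, zero_mul]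
      exact contDiff_const
  -- assemble
  have heq : (fun y : V3 => u ‖y‖) = fun y : V3 =>
      D 0 ‖y‖ + ∑ n ∈ Finset.range (2 * N), c n / (n ! : ℂ) * ((‖y‖ : ℝ) : ℂ) ^ n := by
    funext y
    simp [hD_def]
  rw [heq]
  exact hflat3.add hpoly3

/-- COROLLARY: for `u : ℝ → ℂ` smooth and even, the vector field `y ↦ (Re u ‖y‖)·y` and the scalar `y ↦ Re u ‖y‖` (and
the same with `Im`) are smooth on `ℝ³` — the fields demanded by `IsRegularPair`. [folklore] -/
theorem contDiff_radial_fields_of_even {u : ℝ → ℂ} (hu : ContDiff ℝ ∞ u) (heven : ∀ t, u (-t) = u t) :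
    ContDiff ℝ ∞ (fun y : V3 => (u ‖y‖).re • y) ∧ ContDiff ℝ ∞ (fun y : V3 => (u ‖y‖).im • y) ∧
      ContDiff ℝ ∞ (fun y : V3 => (u ‖y‖).re) ∧ ContDiff ℝ ∞ (fun y : V3 => (u ‖y‖).im) := by
  have h := contDiff_norm_comp_of_even u hu heven
  have hre : ContDiff ℝ ∞ (fun y : V3 => (u ‖y‖).re) := Complex.reCLM.contDiff.comp h
  have him : ContDiff ℝ ∞ (fun y : V3 => (u ‖y‖).im) := Complex.imCLM.contDiff.comp h
  exact ⟨hre.smul contDiff_id, him.smul contDiff_id, hre, him⟩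

end Summit.AtomisticToContinuum.HydrodynamicLimit.Theorems.SonicCavityRenewal

end
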